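import Mathlib
import Literature.NumberTheory.Transcendental.PreBlochGroup
import Literature.NumberTheory.Transcendental.BlochGroupRegulator
import Literature.NumberTheory.Transcendental.PreBlochRelationCriterion
import Literature.NumberTheory.Transcendental.PreBlochRelationCriterionProofs
import HarnessLib

/-!
# `ZagierDilogarithmConjecture` (stmt-KontsevichZagierPeriods-10550) — line
`kummer-clausen-linearisation` (reshape c3, "certificate slice"), stub `stub_dupontOfBorelSuslin`

**Fact hygiene: Dupont's relation criterion from Borel (Neumann's form) and Suslin.** The line's
provable "Galois slice" rests on one deep printed theorem that the Literature renders twice: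

* `Dupont2001_preBloch_relation_of_invariants` (Dupont 2001, Thm. 10.24 a); over an algebraic
  closure `F` of `ℚ`, `ℤ`-form): zero Bloch symbol (against all pairs of additive characters
  `Fˣ → ℚ`) and zero Bloch–Wigner sums `Σ mᵢ D(σ zᵢ)` at every embedding `σ : F → ℂ` put
  `Σ mᵢ [zᵢ]` in the five-term span of `F`;
* `Borel1977_blochGroup_regulator_kernel_torsion` (Neumann 1998, Thm. 3.2 = Borel 1977 + Suslin;
  over a NUMBER FIELD `K`, torsion form): zero wedge pairings and zero regulator components force
  `N • PreBloch.proj ξ = 0` for some `N ≥ 1`.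

This file records that the first follows from the second together with the unique divisibility
of `𝒫(F)` for `F` algebraically closed of characteristic `0`
(`Suslin1991_preBloch_isUniquelyDivisible`, Dupont Thm. 8.16 after Suslin 1991), so the line
depends on a single package of deep input.

Proof. This is exactly the descent `ℚ̄ → K = ℚ(z₁, …, z_k)` of Dupont (10.17), already carried
out in the Literature proof file `PreBlochRelationCriterionProofs`
(`Dupont2001_preBloch_relation_of_invariants_of_borel_suslin`): `K` is a number field; additive
characters `Kˣ → ℚ` extend to `Fˣ → ℚ` (`ℚ` is divisible, Baer), embeddings `K → ℂ` extend to
`F → ℂ` (`F/K` algebraic, `ℂ` algebraically closed), so hypotheses (i), (ii) over `F` give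
Neumann's hypotheses over `K`; Borel puts `N • ξ` in the five-term span of `K`, functoriality of
the presentation along `K ⊆ F` moves it into that of `F`, and unique divisibility removes `N`.
Sorry-free; axioms ⊆ {propext, Classical.choice, Quot.sound}; both deep inputs enter as explicit
hypotheses of the theorem.
-/

noncomputable section

open Literature.NumberTheory.Transcendental

namespace Summit.KontsevichZagierPeriods.HyperbolicBloch.ZagierDilogarithmCertificate

/-- **Stub `stub_dupontOfBorelSuslin` (c3; fact hygiene): Dupont's relation criterion from Borel
(Neumann's form) and Suslin.** Neumann 1998 Thm. 3.2 (Borel: zero Bloch symbol and zero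
regulators ⇒ torsion in `𝒫(K)`, `K` a number field; fact
`Borel1977_blochGroup_regulator_kernel_torsion`) together with the unique divisibility of `𝒫(F)`
for `F` algebraically closed of characteristic `0` (fact `Suslin1991_preBloch_isUniquelyDivisible`)
imply Dupont 2001 Thm. 10.24 a) as rendered (`Dupont2001_preBloch_relation_of_invariants`):
descend the combination to the number field generated by its points, extend `ℚ`-valued characters
and complex embeddings, push the torsion relation to `𝒫(F)` and divide — the Literature's
`Dupont2001_preBloch_relation_of_invariants_of_borel_suslin`.
[cite: Dupont2001, Thm. 10.24 a)] -/
theorem stub_dupontOfBorelSuslin :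
    Borel1977_blochGroup_regulator_kernel_torsion → Suslin1991_preBloch_isUniquelyDivisible →
      Dupont2001_preBloch_relation_of_invariants :=
  fun hBorel hSuslin => Dupont2001_preBloch_relation_of_invariants_of_borel_suslin hBorel hSuslin

end Summit.KontsevichZagierPeriods.HyperbolicBloch.ZagierDilogarithmCertificate

end
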